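import Summits.QuantumFields.YangMills.Theorems.BalabanUVNodesN12MinimiserFamilyKnitRowThm1LettersAtLengthOnZ
import Literature.MathematicalPhysics.QuantumFieldTheory.Balaban1983to89.Node00.MultiScaleFibreChartB
import Literature.MathematicalPhysics.QuantumFieldTheory.Balaban1983to89.B15Prop1Thm1RowsOfExistsUniqueAtLengthBR
import Literature.MathematicalPhysics.QuantumFieldTheory.Balaban1983to89.B15Prop1MinimiserClassAtDatumScaleAtLengthB
import Literature.MathematicalPhysics.QuantumFieldTheory.Balaban1983to89.B15Sect1InstancesB
import Literature.MathematicalPhysics.QuantumFieldTheory.Balaban1983to89.Node00.Record12BgRowCoClassCPMFloorB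
import Literature.MathematicalPhysics.QuantumFieldTheory.Balaban1983to89.B15Prop1MinimiserFamilyOfNormalisedSliceB
import Summits.QuantumFields.YangMills.Theorems.BalabanUVNodesN12MinimiserFamilyAtRecordBjTowerDatumLettersOnZUniformB
import HarnessLib

/-!
# ★ REGULAR-REALISED-DATA EDITION (`…OnZBR`, dag-n12-c g38): this is dag-n12-d g33's `…KnitRowThm1LettersAtLengthOnZB` (✓p782562) VERBATIM except that the (E∕U) letter `h15EUT`
# reads `B11Thm1ExistsUniqueRealisedDataB.DataRegularRealisedTop …` as its data row (the predicate at which the (E∕U)ᴮ name is DISCHARGEABLE from the ONE-LENGTH STEP token,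
# `…N12Thm1EUNameBOfStepAtRealisedDataLam`), and the rows come from the lane's `B15Prop1Thm1RowsOfExistsUniqueAtLengthBR`; the (8)-letter `h15T` keeps `Sect2.DataSmall7PTop`.
# PROVENANCE (O4).  Spec dag-n12-c g38 INBOX l.20148; allocation dag-lead WORDS 473 ∕ 474 (n12-d g34 «MINE» l.20163); bytes TYPED by dag-n12-c g38 (HOME `pub-ymgap-dag-n12-c/lean/g38/rekey/`,
# handed over l.20181, sha16 12daad065ecf6819) and REVIEWED ∕ annotated ∕ filed by seat `pub-ymgap-dag-n12-d` g34 (R134 N12 [B15] s2).  Count-neutral helper of K1⁹ `stmt-QuantumFields-27364`,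
# `--kind proof --supports … --as helper`.  THEOREMS ONLY (0 `def`, 0 `instance`, 0 `sorry`).
#
# BalabanUVNodes ∕ N12 — THE KNIT's (J0′) ROW FOR EVERY BASE FIELD OF THE STRICT GUARD, onZ ∕ AT-LENGTH EDITION: the two [15] letters READ AT THE INSTANCE's OWN LENGTH `k`, the — **BOND-DATUM EDITION** (`…N12MinimiserFamilyKnitRowThm1LettersAtLengthOnZB`, USED DECLARATIONS ONLY)

The print-datum ([Balaban1984PropagatorsII] (2.3)) (γ) twin of `Summits/…/Theorems/BalabanUVNodesN12MinimiserFamilyKnitRowThm1LettersAtLengthOnZ.lean`: the declarations of the parent whose STATEMENT reads the determining datum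
(`exists_R_hMinRow_of_thm1LettersAtLength_alongOrbit_onZ`, `exists_R_hMinRow_of_thm1LettersAtLength_onDatumSliceOnZ`) and which N12's junction of record v14ᴸ uses (dag-n12-c g35 probe-2 census `UsedConstsN12RoadTyped2`, THEOREMS block), re-typed over a
BOND-LEVEL datum `𝔅 : BDetSet` (F0a `B15DeterminingSetsB`) and dag-n12-c's bond-datum chart `Node00.msChartB` (✓p774329; `msChart 𝐁 = msChartB (bondsDet 𝐁)` by `rfl`).  GENERATOR twin
(this seat's `work/g32/gen_thm.py`, block-extracted from the parent's tree bytes): namespace `…N12MinimiserFamilyKnitRowThm1LettersAtLengthOnZB`, SAME short names, `DetSet ↦ BDetSet`, `AgreeOn 𝐁 ↦ AgreeOnB 𝔅`,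
`IsMinimizer ↦ IsMinimizerB`, `bondsOf (𝐁 j) ↦ 𝔅 j`, `msChart ∕ constrCard ∕ constrEnum ∕ ConstrSet ↦ …B`, NODE 00 chart lemmas `…msChart… ↦ …msChartB…`; proofs VERBATIM; the parent's
datum-free declarations REUSED BY NAME (`open`), never copied (private plumbing excepted, №366 R2).  The parent's (b) statements are the instances `𝔅 := bondsDet 𝐁`.
THE KNIT ROWS AT PRINT`s [II] (2.3) DATUM: the two [15]-Theorem-1 letters `h15T` ∕ `h15EUT` are displayed over print`s datum of the sequence `lamBondsSeq s.Ω k` (= `lamDatumP k s.Ω`, `rfl`; `h15T` INHABITED for instances passing `A‴` by this seat`s 114 ✓p774580, `h15EUT` OPEN as in the parent), the (T1@q₀) ∕ uniqueness rows on print`s bonds; the rows (E) ∕ (T1@q₀) per base field by dag-n12-c`s bond-datum edition `B15Prop1Thm1RowsOfExistsUniqueAtLengthB.thm1Rows_atZ_of_thm1TorusClass_existsUnique_atLengthB` AT `bd := lamDatumP` (`hbdΩ := lamBondsSeq_congr`); the (J0′) producer = 164; `hHB` in (b)-currency VERBATIM.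
Cell `pub-ymgap` (HUMAN RULINGS D-0062 ∕ D-0149), seat `pub-ymgap-dag-n12-d` g32 (R134 N12 [B15] s2; the (ii) Theorems-side re-key of N12's road at print's [II] (2.3) datum — director-ym №338 ∕
№343 (E1)(iii-b), FLAG №16 ∕ ruling (α); dag-n12-c DESIGN memo a793b2ebc0b803bf (ii); `N12-ROAD-TWIN-ORDER-2026-08-30.md`).  Count-neutral helper of K1⁹ `stmt-QuantumFields-27364`,
`--kind proof --supports … --as helper`.  THEOREMS ONLY (0 `def`, 0 `instance`, 0 `sorry`).

HONEST FRAMING (director-ym №338 (5)).  PURELY ADDITIVE: the parent stays landed and true on its own text; nothing in it is edited; no displayed premise of any consumer is deleted or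
weakened; every hypothesis of the parent stays a hypothesis.  Nothing of Bałaban's analysis asserted; N12 NOT discharged; K0⁷ ∕ K1⁹ NOT closed; counts unmoved (typed 28∕28 · discharged
8∕27, A 8∕28; K 1∕4); one finite 𝕋⁴ programme at fixed ε — R4 closes the conditional rung `BalabanLadder.UV` only; NOT the Yang–Mills mass gap (Clay); nothing continuum ∕ ℝ⁴ ∕ OS.

PARENT's DOCSTRING (the mathematics and the citations; read the site-level `𝐁` as the bond datum `𝔅`):
# BalabanUVNodes ∕ N12 — THE KNIT's (J0′) ROW FOR EVERY BASE FIELD OF THE STRICT GUARD, onZ ∕ AT-LENGTH EDITION: the two [15] letters READ AT THE INSTANCE's OWN LENGTH `k`, the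
# COMPACT onZ slice, and the return along the gauge orbit — the knit-side terminus of census item E1 at BOX SCOPE, in the shape the K0 road's guarded token serves
# ([Balaban1985Variational] (1) p.277, (2)–(7) p.278, Thm 1 (8) p.279, Sect. C (44)–(48) p.285, (81)–(83) p.290, Sect. G pp.305–307, (181) p.307, Prop. 9 (190) p.309;
# [Balaban1989LargeFieldI] (1.74) p.192, p.193 ll.14–20, Prop. 1 p.194; [Balaban1985RegularSpaces] (1.3)–(1.9) p.77; [Balaban1989LargeFieldII] p.357, (1.7)–(1.9) p.358,
# (1.12)–(1.13) p.359; [Balaban1988Convergent] (2.1)–(2.2) pp.254–255, (2.10)–(2.13) pp.256–257, (2.18) p.257; [Balaban1985Averaging] (8)–(9) pp.18–19, Prop. 2 (52)–(54) p.26,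
# (122)–(126) p.36; [Balaban1987RG1] (0.4) p.253)

Cell `pub-ymgap` (HUMAN RULINGS D-0062 ∕ D-0149), seat `pub-ymgap-dag-n12-d` g26 (R134 N12 [B15] s2 = by-name knit at the record; census item E1 = the (J0′) row; count-neutral helper of K1⁹
`stmt-QuantumFields-27364`, `--kind proof --supports … --as helper`).  THEOREMS ONLY (0 `def`, 0 `instance`, 0 `sorry`); compositions BY NAME.  AT-LENGTH EDITION of this seat's
`…KnitRowThm1LettersOnZ` (p734359, g25) ∕ the lane dag-n12-c g29's length-guarded re-key `…KnitRowThm1LettersOnZPos` (p739163) — the text of the latter byte for byte except the two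
[15] letter binders (now AT THE INSTANCE's LENGTH `k`, no `∀ k'`), the junction called (`B15Prop1Thm1RowsOfExistsUniqueAtLength.thm1Rows_atZ_of_thm1TorusClass_existsUnique_atLength`), names
and this header.  Sixth leaf of the junction family; the onZ
twin of this seat's `N12MinimiserFamilyKnitRowThm1Letters` (p731210, whose §0 continuity kit is consumed here by name).

THE ROAD (all by name).  Producer: the lane's εreg-uniform (J0′) letter at `𝐁_k(Z)` over NODE 00's class, datum-letter-on-`Z^{(k)}` edition U3-onZ (dag-n12-c g27;
dag-n12-w6 g18's (σ)_N-onZ `N12GaugeLetterLocExplicitOnZ` inside — the cure of ⚑ LOCATED-DATUM-FAR by `N12FarDatumSurgery`: (2.12) minimisers do not read the datum off `Z`) → this seat's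
(C″)-onZ `N12MinimiserFamilyAtRecordBjTowerDatumLettersOnZUniform` (forest, class facts, (σ)_N class numerics discharged) → §1 HERE: fed on the COMPACT onZ slice (closed guard ∩
{`ext V_k` `ρn`-flat on the `k`-bonds inside `Z^{(k)}`}; compactness by `…KnitRowThm1Letters` §0: `SU(2)^{bonds}` compact, guard closed, `V_k ↦ (ext V_k)(c)` continuous), with [15] Thm 1's
rows (E) ∕ (T1@q₀) from the lane's two CLOSED instance-independent letters `h15T` ∕ `h15EUT` (`B15Prop1Thm1RowsOfExistsUnique`) — NO per-base-field hypothesis, the onZ datum letter a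
per-base-field ANTECEDENT; → §2 HERE: the antecedent REMOVED along the gauge orbit by the lane's `B15Prop1MinimiserFamilyOfNormalisedSlice.hMinBody_of_datumSlice` (dag-n12-w6's [IV]
p. 193 normalising gauge `B15Prop1DatumGaugeNormalisation` §7 + the lane's covariance `B15Prop1MinimiserFamilyGaugeCovariance`, the cure of ⚑ LOCATED-GAUGE-ORBIT) at BOX SCOPE: every
`k`-bond inside `Z^{(k)}` is a bond of one non-wrapping region box whose plaquettes lie in `Z^{(k)}` (the direct road's rows; LOCATED-GEOM v3 for ring-like `Z` unchanged, displayed).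

RESULT (E1, knit side): `exists_R_hMinRow_of_thm1LettersAtLength_alongOrbit_onZ` — per (instance, height), after the per-height existence letters, the (σ)_N numerics and the two AT-LENGTH [15]
letters, ONE announced `δ₀ > 0`; then for every fine window with its geometry rows, region box, guard radius `eR`, extension, `𝓐₀ > 1`, class tolerance `εr` (five rows + [15]'s
comparability rows at `ε := 2eR`) and datum tolerance `ρn` (U3's «T ≤ δ₀» + the normaliser's coupling): `∃ R > 0, ∀ V_k, strict guard → <the knit's hMin ∀-body at V_k, bound 4𝓐₀>`.

WHY AT LENGTH (dag-n12-d g26; LOCATED typing-strength of a displayed letter vs its producer of record, count-neutral).  The `_pos` editions display `h15T` ∕ `h15EUT⁺` quantified over ALL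
lengths `k' ≤ m + K` although the junction reads them once, at `k' = k`.  The (8)-letter's producer of record is the K0 road, whose REGISTERED currency (K0⁷ stmt-QuantumFields-20541,
skeleton V22-Z: stub-1 text `K0V22ZDefs.Prop8StepCoPGridGAt F` → dag-n07-e's `variationalThm1RegSepCoP7MG_of_prop8TopStepG`) is the GRID-GUARDED sentence
`Node00.VariationalThm1RegSepCoP7MG F 2 A‴(c, c₀, c₁) B₃ a₀ a₁` — it serves the torus-class letter only at lengths `k'` with `k' + c₀ ≤ m + K` (and numerics `c ≤ M₁`, `L^{c₁} ∣ M₁`), never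
at all `k' ≤ m + K`; the floor-free `…SepCoP7M` named in the «INHABITED BY» comments implies every guarded sentence (`.toG`), not conversely.  THIS EDITION therefore displays both
letters AT THE INSTANCE's OWN LENGTH `k` (the `_pos` bodies at `k' := k`; the rows `k + 1 ≤ m + K`, `1 ≤ k`, `LᵏM₁ ∣ sitesPerDir 0` are `hkK` ∕ `hk1` ∕ `hdiv`), so that ANY producer
guarded in the length serves exactly the instances passing its guard — the K0-keyed head is `BalabanUVNodesN12MinimiserFamilyKnitRowOfK0GridGOnZOfRecord` — and the `_pos`
letters serve every instance (instantiate at `k`).  Proofs: the `_pos` proofs verbatim, the lane's junction replaced by its at-length edition at `ι := Unit` with the letters `fun _ => h15T`,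
`fun _ => h15EUT`.

HONEST FRAMING ∕ LOCATED.  Compositions by name; [15] Thm 1 ((8), existence, uniqueness) stays DISPLAYED as the two letters `h15T`∕`h15EUT` at the instance's length `k ≥ 1` (producer of
`h15T` = the K0 road's guarded (8)-token at instances passing its guard, K0⁷ OPEN; `h15EUT` = [15] Thm 1 (E∕U) has NO producer in the tree — orphan edge N07→N12); per-height letters inhabited elsewhere (dag-n12-w6 `exists_hsurjLetters`), displayed here; scope = BOX scope, displayed; `δ₀`, `R`, `ρ″`, `εH`, `B` = EXISTENCE
constants per (instance, height) (census U4: print's volume-uniform (46)∕(83) and `k`-uniformity NOT claimed); nothing of Bałaban's estimates asserted; N12 NOT discharged; K1⁹ NOT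
closed; counts unmoved; one finite 𝕋⁴ programme at fixed `ε = L^{-K}` — R4 closes only the conditional rung `BalabanLadder.UV`; no summit statement is proved here and NOT the
Yang–Mills mass gap (Clay); nothing continuum ∕ ℝ⁴ ∕ OS.
-/

noncomputable section

namespace Summit.QuantumFields.YangMills.BalabanUVNodes.N12MinimiserFamilyKnitRowThm1LettersAtLengthOnZBR

open Literature.MathematicalPhysics.QuantumFieldTheory.Balaban1983to89.B15DeterminingSetsB

open scoped BigOperators Matrix.Norms.L2Operator Topology
open Literature.MathematicalPhysics.QuantumFieldTheory.Balaban1983to89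
open T4Continuum
open B15DeterminingSets GaugeField
open ExpMeanLog (expMeanLogSU deltaSU)
open T4AdjointCovarianceUnitary (lieSU)
open Node00
open B15Prop1AnalyticExtClause (cplxVec)
open B15Prop1ChartCalculusSU2 (E3)
open T4CubeChartGnomonic (SU2)
open B14.Eq213DetSet (Bj maxDomT)
open B14.Eq213MaximalDomains (side)
open B14.Eq22Determines (IsBlockUnion)
open B14.Eq216Concrete (feeds)
open B5Eq118OneStroke (iterBlockOf)
open B15Eq112TorusCover (lift)
open T4AxialGaugeSmallField (boxPlaqs castSite)
open B15Prop1Carrier (plaqsInside)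
open Literature.MathematicalPhysics.QuantumFieldTheory.BalabanImbrieJaffe1984to88.BIJ85Eq453GaugeField (qsstarGIter0)
open B15ShellGauge193 (shellGauge)
open B15Extension193 (extend)
open B16Sect1Backgrounds (toMS expMul)
open B15Prop1ChartSU2 (su2Chart)
open Metric (ball)
open B15Prop1ClosedGuardUniformRadius (isCompact_setOf_plaqLeOn plaqLeOn_of_plaqSmallOn)
open B15ShellGauge193Local (dist1_plaqHol_extend_shellGauge_le)
open B15Extension193 (cutoff primed Touches)
open B12ContinuousTransportInvarianceOn (continuous_dist1_SU)
open T4AxialGaugeSmallField (boxBonds)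
open B15Prop1MinimiserFamilyOfNormalisedSliceB (hMinBody_of_datumSlice)
open Summit.QuantumFields.YangMills.BalabanUVNodes.N12MinimiserFamilyKnitRowThm1Letters (boxRow3_of_boxRow5 isCompact_guard_inter_datumSlice)
open Summit.QuantumFields.YangMills.BalabanUVNodes.N12MinimiserFamilyAtRecordBjTowerDatumLettersOnZUniformB (hMin_atRecord_lamBondsSeq_of_printLetters_ofClassDatumLettersOnZUniform)
open Node00 (msChart constrCard constrEnum)
open B15Prop1Thm1RowsOfExistsUniqueAtLengthBR (thm1Rows_atZ_of_thm1TorusClass_existsUnique_atLengthBR)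
open B15Prop1MinimiserClassAtDatumScaleAtLengthB (lamBondsSeq_congr)
open B15Sect1Instances (lamDatumP)

section
variable {F : T4Family} {k : ℕ}

/-- ★★★★ **THE KNIT's (J0′) ROW SHAPE, εreg-UNIFORM, FROM THE TWO [15] LETTERS AT THE INSTANCE's LENGTH, onZ EDITION** — this seat's (C″)-onZ `hMin_atRecord_lamBondsSeq_of_printLetters_ofClassDatumLettersOnZUniform`
(over the lane's U3-onZ: dag-n12-w6's (σ)_N-onZ inside, numerics `hkc hc hMrad hM₁`, datum bond tolerance `ρn` with «`T(ρn, εr) ≤ δ₀`») at the COMPACT slice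
`K′ := {closed guard ≤ eR on (Z ∩ Λᶜ)^{(k)}} ∩ {V_k | ∀ c ∈ {e | e.src ∈ pts k Z ∧ e.tgt ∈ pts k Z}, dist1 ((ext V_k) c) ≤ ρn}` (`isCompact_guard_inter_datumSlice`), datum tolerance
`δ := 2(c_E+1)eR`; on `K′`: (E) and (T1@q₀) by the AT-LENGTH edition `thm1Rows_atZ_of_thm1TorusClass_existsUnique_atLength` of the lane's junction (ι := Unit, ε := 2eR) from the two [15]
letters `h15T`∕`h15EUT` READ AT THIS INSTANCE's LENGTH `k`, the datum's
plaquette regularity from the guard (`dist1_plaqHol_extend_shellGauge_le`), the onZ datum letter by membership.  Conclusion: `∃ R > 0, ∀ V_k, strict guard → (∀ c ∈ {k-bonds inside Z^{(k)}},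
dist1 ((ext V_k) c) ≤ ρn) → <12Q ∕ 12X-W v11 hMin ∀-body (class at εr)>`.
[cite: Balaban1985Variational, (2)–(7) p.278, Thm 1 (8) p.279, Sect. C (44)–(48) p.285, (81)–(83) p.290, (181) p.307, Prop. 9 (190) p.309; Balaban1989LargeFieldI, (1.74) p.192, p.193 L14–20, Prop. 1 p.194; Balaban1985RegularSpaces, (1.3)–(1.9) p.77; Balaban1989LargeFieldII, (1.12)–(1.13) p.359; Balaban1988Convergent, (2.1)–(2.2) pp.254–255, (2.10)–(2.13) pp.256–257, (2.18) p.257; Balaban1985Averaging, Prop. 2 (52)–(54) p.26, (122)–(126) p.36; Balaban1987RG1, (0.4) p.253] -/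
theorem exists_R_hMinRow_of_thm1LettersAtLength_onDatumSliceOnZ (ν : Node00.Stage7Numerics) (Kt : ℕ) (hd3 : 3 ≤ (F.P Kt).d) (Z : Set (Site (F.P Kt) 0))
    (hkK : k + 1 ≤ (F.P Kt).m + (F.P Kt).K) (hk1 : 1 ≤ k) (hdiv : side (F.P Kt).L ν.M₁ k ∣ (F.P Kt).sitesPerDir 0) (hfloor : ((F.P Kt).d + 14) * (F.P Kt).L ≤ ν.M₁) (hZblk : IsBlockUnion k Z)
    -- the per-HEIGHT letters (EXISTENCE constants per (instance, height); dag-n12-w6's `N12HsurjOfClass.exists_hsurjLetters`)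
    {ρ'' : ℝ} (hsbU : ∀ W : GaugeField (F.P Kt) 0 SU2, ‖coeField W - 1‖ ≤ ρ'' → SmallBelow (Node00.avOfRecord F 2 Kt) k W) (hρ : 0 < ρ'')
    {εH B : ℝ}
    (hHB : ∀ (Wd : MSField (F.P Kt) SU2) (U₀ : GaugeField (F.P Kt) 0 SU2),
      AgreeOn (Bj ν.M₁ Z k) (avgFamily (avOfRecord F 2 Kt) U₀) Wd →
      (∀ i' : Fin (constrCard (Bj ν.M₁ Z k) k), ∃ U' : GaugeField (F.P Kt) 0 SU2,
        (∀ b ∈ feeds (((constrEnum (Bj ν.M₁ Z k) k).symm i').1 : ℕ) ((constrEnum (Bj ν.M₁ Z k) k).symm i').2.1, U' b = U₀ b) ∧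
          SmallBelow (avOfRecord F 2 Kt) k U') →
      (∀ (j : ℕ), 1 ≤ j → j ≤ k → ∀ y : Site (F.P Kt) j, embIter j y ∈ maxDomT ν.M₁ Z j → ∃ U' : GaugeField (F.P Kt) 0 SU2,
        (∀ c : PBond (F.P Kt) j, (c.src = y ∨ c.tgt = y) → ∀ b₀ : PBond (F.P Kt) 0,
          (iterBlockOf j b₀.src = c.src ∨ iterBlockOf j b₀.src = c.tgt) → (iterBlockOf j b₀.tgt = c.src ∨ iterBlockOf j b₀.tgt = c.tgt) → U' b₀ = U₀ b₀) ∧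
        SmallBelow (avOfRecord F 2 Kt) k U') →
      (∀ (j : ℕ), 1 ≤ j → j ≤ k → ∀ y : Site (F.P Kt) j, embIter j y ∈ maxDomT ν.M₁ Z j →
        PlaqSmallOn (boxPlaqs (fun κ => lift (F.P Kt) (embIter j y) κ - ((((F.P Kt).L ^ j : ℕ) : ℤ) + ((((F.P Kt).L ^ j - 1) / 2 : ℕ) : ℤ)))
          (fun κ => lift (F.P Kt) (embIter j y) κ + ((((F.P Kt).L ^ j : ℕ) : ℤ) + ((((F.P Kt).L ^ j - 1) / 2 : ℕ) : ℤ))) : Set (Plaq (F.P Kt) 0)) εH U₀) →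
      ∃ H : (Fin (constrCard (Bj ν.M₁ Z k) k) → lieSU (Fin 2)) → PBond (F.P Kt) 0 → lieSU (Fin 2),
        (∀ v, fderiv ℝ (msChart F 2 Kt k (Bj ν.M₁ Z k) Wd U₀) 0 (H v) = v) ∧ ∀ v, Real.sqrt (∑ b, ‖H v b‖ ^ 2) ≤ B * ‖v‖) (hB0 : 0 ≤ B)
    -- (σ)_N OF RECORD, onZ EDITION (dag-n12-w6 g18's `N12GaugeLetterLocExplicitOnZLam.exists_gaugeLetterLoc_atRecord_lamBondsSeq_explicit_onZ` inside the lane's U3-onZ), instance-level NUMERICS verbatim: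
    -- NUMERICS (i): a level guard `k + c ≤ m + K` with `4d + m′ + 3 < 2·L^c` (no wrapping), and `M₁ ≥ (4d + m′)·L² + 2d·L + 12` (radii), `m′ = 3·(d·((L−1)∕2)) + 5`
    {c : ℕ} (hkc : k + c ≤ (F.P Kt).m + (F.P Kt).K) (hc : 4 * (F.P Kt).d + (3 * ((F.P Kt).d * (((F.P Kt).L - 1) / 2)) + 5) + 3 < 2 * (F.P Kt).L ^ c)
    (hMrad : (4 * (F.P Kt).d + (3 * ((F.P Kt).d * (((F.P Kt).L - 1) / 2)) + 5)) * (F.P Kt).L ^ 2 + 2 * (F.P Kt).d * (F.P Kt).L + 12 ≤ ν.M₁)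
    -- the family's support numerics: `M₁ ≥ ((d+4)L + 6)·L²`
    (hM₁ : (((F.P Kt).d + 4) * (F.P Kt).L + 6) * (F.P Kt).L ^ 2 ≤ ν.M₁)
    -- THE TWO [15]-THEOREM-1 LETTERS over NODE 00's torus class, READ AT THIS INSTANCE's OWN LENGTH `k`; the (8)-letter `h15T` with the record's (7) row `Sect2.DataSmall7PTop`, the (E∕U)
    -- letter `h15EUT` AT REGULAR-REALISED DATA `B11Thm1ExistsUniqueRealisedDataB.DataRegularRealisedTop …` (dag-n12-c g38 ✓p782648; rows by its `B15Prop1Thm1RowsOfExistsUniqueAtLengthBR`).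
    -- «INHABITED BY» at `bd := lamDatumP` and K0⁷'s grid guard `A‴(c,c₀,c₁)`: `h15T` = the body of the (R)ᴮ name `Node00.VariationalThm1RegSepCoP7MGB F 2 A‴ (lamDatum F) (dataSmall7LamTopOf F 2) …`
    --   through the record's (7) (113 §5) — INHABITED for K0⁷'s stub-1 constants (`K0Stub1BHolds`, 114 ✓p774580); `h15EUT` = the body of the (E∕U)ᴮ name
    --   `B11Thm1ExistsUniqueTokensGB.VariationalThm1EUSepCoP7MGB F 2 A‴ (lamDatum F) (dataRegularRealisedTopOf F 2) …`, which dag-n12-c's `…N12Thm1EUNameBOfStepAtRealisedDataLam` ✓p782822∕✓p782912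
    --   derives from THE ONE-LENGTH STEP TOKEN `VariationalThm1EUStepCoP7MGB F 2 A‴ (lamDatum F) (dataSmall7LamTopOf F 2) C₁ …` ([15] Prop. 2 + Sects. B–E at one length — OPEN, N07);
    --   the composition is dag-n12-d's `…LettersDischargedAtLengthOfK0Stub1BAndStepOfRecord`
    {B₃ a₀ a₁ : ℝ}
    (h15T : ∀ (s : B14.Eq218Concrete.Seq (fun n : ℕ => Node00.unionsOfCubes (F.P Kt) (side (F.P Kt).L ν.M₁ n)) k),
      Node00.Sect2.SeqSeparated ν.M₁ s → 0 < ν.M₁ →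
      ∀ (ε₀ : ℝ) (δ : ℕ → ℝ), (∀ j, j ≤ k → 0 < δ j ∧ δ j ≤ a₁ ∧ B₃ * δ j ≤ ε₀) → (∀ j, j < k → δ j ≤ 2 * δ (j + 1)) →
      (∀ j, j < k → δ (j + 1) ≤ 2 * δ j) → ε₀ ≤ a₀ →
      ∀ W : MSField (F.P Kt) SU2,
        Node00.Sect2.DataSmall7PTop (Node00.avOfRecord F 2 Kt) s.Ω (Node00.suppDomOfRecord F ν Kt s.Ω) k δ W →
        ∀ U₀ : GaugeField (F.P Kt) 0 SU2, IsMinimizerB (Node00.avOfRecord F 2 Kt)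
            {U | (∀ j, j ≤ k → PlaqSmallOn (Node00.Sect2.omegaPlaqsTop s.Ω (Node00.suppDomOfRecord F ν Kt s.Ω) j)
                (ε₀ * (F.P Kt).eta j ^ 2) U) ∧
              Node00.Sect2.CoDivClassOnTop s.Ω (Node00.suppDomOfRecord F ν Kt s.Ω) k ε₀ U}
            (lamBondsSeq s.Ω k) W U₀ →
          (∀ j, j ≤ k → PlaqSmallOn (Node00.Sect2.omegaPlaqsTop s.Ω (Node00.suppDomOfRecord F ν Kt s.Ω) j)
              (B₃ * δ j * (F.P Kt).eta j ^ 2) U₀) ∧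
            ∀ j, j ≤ k → Node00.Sect2.CoDivSmallOn (Node00.Sect2.omegaBondsTop s.Ω (Node00.suppDomOfRecord F ν Kt s.Ω) j)
              (B₃ * δ j * (F.P Kt).eta j ^ 3) U₀)
    (h15EUT : ∀ (s : B14.Eq218Concrete.Seq (fun n : ℕ => Node00.unionsOfCubes (F.P Kt) (side (F.P Kt).L ν.M₁ n)) k),
      Node00.Sect2.SeqSeparated ν.M₁ s → 0 < ν.M₁ →
      ∀ (ε₀ : ℝ) (δ : ℕ → ℝ), (∀ j, j ≤ k → 0 < δ j ∧ δ j ≤ a₁ ∧ B₃ * δ j ≤ ε₀) → (∀ j, j < k → δ j ≤ 2 * δ (j + 1)) →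
      (∀ j, j < k → δ (j + 1) ≤ 2 * δ j) → ε₀ ≤ a₀ →
      ∀ W : MSField (F.P Kt) SU2,
        B11Thm1ExistsUniqueRealisedDataB.DataRegularRealisedTop (Node00.avOfRecord F 2 Kt) s.Ω (Node00.suppDomOfRecord F ν Kt s.Ω) k δ W →
        (∃ U₀ : GaugeField (F.P Kt) 0 SU2, IsMinimizerB (Node00.avOfRecord F 2 Kt)
            {U | (∀ j, j ≤ k → PlaqSmallOn (Node00.Sect2.omegaPlaqsTop s.Ω (Node00.suppDomOfRecord F ν Kt s.Ω) j)
                (ε₀ * (F.P Kt).eta j ^ 2) U) ∧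
              Node00.Sect2.CoDivClassOnTop s.Ω (Node00.suppDomOfRecord F ν Kt s.Ω) k ε₀ U}
            (lamBondsSeq s.Ω k) W U₀) ∧
        ∀ U₁ U₂ : GaugeField (F.P Kt) 0 SU2,
          IsMinimizerB (Node00.avOfRecord F 2 Kt)
            {U | (∀ j, j ≤ k → PlaqSmallOn (Node00.Sect2.omegaPlaqsTop s.Ω (Node00.suppDomOfRecord F ν Kt s.Ω) j)
                (ε₀ * (F.P Kt).eta j ^ 2) U) ∧
              Node00.Sect2.CoDivClassOnTop s.Ω (Node00.suppDomOfRecord F ν Kt s.Ω) k ε₀ U}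
            (lamBondsSeq s.Ω k) W U₁ →
          IsMinimizerB (Node00.avOfRecord F 2 Kt)
            {U | (∀ j, j ≤ k → PlaqSmallOn (Node00.Sect2.omegaPlaqsTop s.Ω (Node00.suppDomOfRecord F ν Kt s.Ω) j)
                (ε₀ * (F.P Kt).eta j ^ 2) U) ∧
              Node00.Sect2.CoDivClassOnTop s.Ω (Node00.suppDomOfRecord F ν Kt s.Ω) k ε₀ U}
            (lamBondsSeq s.Ω k) W U₂ →
          ∃ u : GaugeTransf (F.P Kt) 0 SU2,
            (∀ j, j ≤ k → ∀ b ∈ lamBondsSeq s.Ω k j, toMS u j b.src = toMS u j b.tgt ∧ ∀ g : SU2, toMS u j b.src * g = g * toMS u j b.src) ∧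
              gaugeAct u U₁ = U₂) :
    ∃ δ₀ : ℝ, 0 < δ₀ ∧
    ∀ (Λ : Set (Site (F.P Kt) 0)) (lo hi : Fin (F.P Kt).d → ℤ) (eR : ℝ), 0 < eR →
    ∀ (n : ℕ), (∀ κ, hi κ ≤ lo κ + n) → (∀ κ, ((hi κ - lo κ + 1).toNat : ℤ) + 5 < ((F.P Kt).sitesPerDir k : ℤ)) → lo ≤ hi →
      pts k Λ = (castSite '' Set.Icc lo hi : Set (Site (F.P Kt) k)) → (boxPlaqs (lo - 1) (hi + 1) : Set (Plaq (F.P Kt) k)) ⊆ plaqsInside (pts k Z) →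
    ∀ {cE : ℝ}, 12 * ((F.P Kt).d : ℝ) * ((n : ℝ) + 2) ^ 2 ≤ cE → 6 * ((((F.P Kt).d - 1 : ℕ)) : ℝ) * (F.P Kt).L ^ k * (2 * ((cE + 1) * eR)) ≤ ρ'' →
    ∀ (ext : GaugeField (F.P Kt) k SU2 → GaugeField (F.P Kt) k SU2), (∀ W, ext W = extend (pts k Λ) (shellGauge W lo hi) W) →
    ∀ {𝓐₀ : ℝ}, 1 < 𝓐₀ →
    ∀ (εr : ℝ), 0 < εr → 12 * ((((F.P Kt).d - 1 : ℕ)) : ℝ) * (F.P Kt).L * εr ≤ ρ'' → εr ≤ εH →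
      (143 * (((((F.P Kt).d + 4 : ℕ) : ℝ)) ^ 2 / 4) ^ 2) * (2 * ((F.P Kt).L : ℝ) ^ 2 * εr) ≤ 1 / 3 →
      2 * (2 * ((F.P Kt).L : ℝ) ^ 2 * εr) ≤ 2 * deltaSU (Fin 2) / ((((F.P Kt).d + 4) * (F.P Kt).L : ℕ) : ℝ) ^ 2 →
    -- [15]'s comparability rows at `ε := 2eR`
    ∀ {ε₀ : ℝ}, (cE + 1) * (2 * eR) ≤ a₁ → B₃ * ((cE + 1) * (2 * eR)) ≤ εr → εr < ε₀ → ε₀ ≤ a₀ →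
    -- the datum bond tolerance `ρn` with U3's «`T(ρn, εr) ≤ δ₀`» row (VERBATIM)
    ∀ {ρn : ℝ}, 0 ≤ ρn →
    (max ρn ((((2 * (∑ i ∈ Finset.range (k + 1), ((F.P Kt).d * (((F.P Kt).L ^ i - 1) / 2) + 1)) + 1 +
                  (3 * ((F.P Kt).d * (((F.P Kt).L - 1) / 2)) + 5) * (F.P Kt).L ^ k : ℕ) : ℝ)) ^ 2 / 4 * (εr * (F.P Kt).eta 0 ^ 2) +
                ((3 * ((F.P Kt).d * (((F.P Kt).L - 1) / 2)) + 5 : ℕ) : ℝ) * (6 * ((((((F.P Kt).d + 2) * (F.P Kt).L : ℕ) : ℝ) ^ 2 / 4) * (2 * (εr * (F.P Kt).L ^ 2))) * ∑ i ∈ Finset.range k, ((F.P Kt).L : ℝ) ^ i) + ((3 * ((F.P Kt).d * (((F.P Kt).L - 1) / 2)) + 5 : ℕ) : ℝ) * ρn) ≤ δ₀) →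
    -- NO PER-BASE-FIELD HYPOTHESIS: the onZ datum letter is an antecedent INSIDE the conclusion (SET form over the `k`-bonds inside `Z^{(k)}`)
    ∃ R : ℝ, 0 < R ∧ ∀ Vk : GaugeField (F.P Kt) k SU2, PlaqSmallOn (plaqsInside (pts k (Z ∩ Λᶜ))) eR Vk → (∀ c ∈ {e : PBond (F.P Kt) k | e.src ∈ pts k Z ∧ e.tgt ∈ pts k Z}, dist1 ((ext Vk) c) ≤ ρn) →
      ∃ Ũ : VecField (F.P Kt) k (EuclideanSpace ℂ (Fin 3)) × VecField (F.P Kt) k (EuclideanSpace ℂ (Fin 3)) → PBond (F.P Kt) 0 → Matrix (Fin 2) (Fin 2) ℂ,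
        (∀ b i j, DifferentiableOn ℂ (fun z => Ũ z b i j) (ball 0 R)) ∧
        (∀ z ∈ ball (0 : VecField (F.P Kt) k (EuclideanSpace ℂ (Fin 3)) × VecField (F.P Kt) k (EuclideanSpace ℂ (Fin 3))) R, ∀ b i j, ‖Ũ z b i j‖ ≤ 𝓐₀) ∧
        ∀ p B' : VecField (F.P Kt) k E3, ‖p‖ < R → ‖B'‖ < R → ∃ U' : GaugeField (F.P Kt) 0 SU2,
          (∀ b, Ũ (cplxVec p, cplxVec B') b = ((U' b : SU2) : Matrix (Fin 2) (Fin 2) ℂ)) ∧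
            IsMinimizerB (Node00.avOfRecord F 2 Kt) (Node00.regMSCoPOfRecord F 2 {ν with εreg := εr} Kt k (maxDomT ν.M₁ Z)) (lamBondsSeq (maxDomT ν.M₁ Z) k)
              (avgFamily (Node00.avOfRecord F 2 Kt) (qsstarGIter0 k (expMul su2Chart B' (ext (expMul su2Chart p Vk))))) U' := by
  obtain ⟨δ₀, hδ₀, h⟩ := hMin_atRecord_lamBondsSeq_of_printLetters_ofClassDatumLettersOnZUniform ν Kt hd3 Z hkK hk1 hdiv hfloor hZblk hsbU hρ hHB hB0 hkc hc hMrad hM₁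
  refine ⟨δ₀, hδ₀, ?_⟩
  intro Λ lo hi eR heR n hn hN5 hlohi hbox hZ cE hcE hδρ ext hext 𝓐₀ h𝓐₀ εr hεr hερ hεH hα3 hα2 ε₀ hεa₁ hB₃ε hεr0 hε₀ ρn hρn hT
  have hN3 := boxRow3_of_boxRow5 hlohi hN5
  have hcE0 : 0 ≤ cE := le_trans (by positivity) hcE
  have hδ : 0 < 2 * ((cE + 1) * eR) := by positivity
  have hM2 : 2 ≤ ν.M₁ := by
    have hL := (F.P Kt).L_pos
    nlinarith [hfloor, hd3]
  have H15 := thm1Rows_atZ_of_thm1TorusClass_existsUnique_atLengthBR ν Kt hd3 (ι := Unit) (fun _ => Z) (fun _ => Λ) (fun _ => k) (fun _ => hk1)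
    (fun _ => (by omega : k ≤ (F.P Kt).m + (F.P Kt).K)) (fun _ => lo) (fun _ => hi) (fun _ => n) (fun _ => hn) (fun _ => hbox) (fun _ => hZ) (fun _ => hN5)
    (fun _ => ext) (fun _ => hext) (fun _ => hlohi) (fun _ => hZblk) hM2 (fun _ => hdiv) lamDatumP (fun _ Ω Ω' hΩ => lamBondsSeq_congr hk1 Ω Ω' hΩ)
    hcE0 (fun _ => hcE) (fun _ => h15T) (fun _ => h15EUT)
  -- (C″)-onZ on the COMPACT normalised slice `K′ := closed guard ∩ onZ datum slice`
  have hK := isCompact_guard_inter_datumSlice (plaqsInside (pts k (Z ∩ Λᶜ))) eR (pts k Λ) lo hi ext hext {e : PBond (F.P Kt) k | e.src ∈ pts k Z ∧ e.tgt ∈ pts k Z} ρn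
  obtain ⟨R, hR, h'⟩ := h (pts k Λ) lo hi hδ hδρ ext hext hK h𝓐₀ εr hεr hερ hεH hα3 hα2 hρn hT fun Vk hVk => by
      obtain ⟨hVk, hD⟩ := hVk
      have h2 : PlaqSmallOn (plaqsInside (pts k (Z ∩ Λᶜ))) (2 * eR) Vk := fun q hq => (hVk q hq).trans_lt (by linarith)
      obtain ⟨⟨U₀, hmin⟩, hT1⟩ := H15 () εr ε₀ (2 * eR) Vk (by positivity) hεa₁ hB₃ε hεr0 hε₀ h2
      refine ⟨U₀, hmin, fun p hp => ?_, fun e hs ht => hD e ⟨hs, ht⟩, hT1 U₀ hmin⟩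
      have hreg := (dist1_plaqHol_extend_shellGauge_le (G := SU2) hd3 hlohi hn hN3 hbox hZ (by positivity) h2).1 p hp
      rw [hext]
      refine hreg.trans_lt ?_
      have h1 : 12 * ((F.P Kt).d : ℝ) * ((n : ℝ) + 2) ^ 2 * (2 * eR) ≤ cE * (2 * eR) := mul_le_mul_of_nonneg_right hcE (by positivity)
      have h3 : cE * (2 * eR) + 2 * eR = 2 * ((cE + 1) * eR) := by ring
      linarith
  exact ⟨R, hR, fun Vk hVk hD => h' Vk ⟨plaqLeOn_of_plaqSmallOn hVk, hD⟩⟩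

end

section
variable {F : T4Family} {k : ℕ}

/-- ★★★★★ **THE KNIT's (J0′) ROW FOR EVERY BASE FIELD OF THE STRICT GUARD — NO PER-BASE-FIELD HYPOTHESIS, NO ANTECEDENT** — §1 composed with the lane's
`B15Prop1MinimiserFamilyOfNormalisedSliceB.hMinBody_of_datumSlice` ([IV] p. 193: dag-n12-w6's normalising gauge `ũ`, `= 1` on `Λ^{(k)}` and at the corner, carries every base field of the
strict guard into the onZ slice at box scope; the lane's gauge COVARIANCE of the minimiser family returns along the orbit with radius `R∕3`, bound `4𝓐₀`).  Displayed ONCE per (instance,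
height): per-height letters `ρ″ hsbU εH B hHB`, (σ)_N numerics `hkc hc hMrad hM₁`, the two AT-LENGTH [15] letters `h15T`∕`h15EUT`; after `δ₀`: window + geometry rows (12Q v11's `hn hN5 hlohi
hbox hZ hcE`), REGION BOX rows (`LO ≤ lo−1`, `hi+1 ≤ HI`, `n′ < sitesPerDir k`, `boxPlaqs LO HI ⊆ plaqsInside (pts k Z)`, BOX SCOPE «every `k`-bond inside `Z^{(k)}` is a bond of the
box»), budget, `ext`, `𝓐₀ > 1`, five `εr` rows, [15]'s comparability rows at `ε := 2eR`, `ρn ≥ 0` + «T ≤ δ₀» + the normaliser's coupling `C(d,n,n′)·eR ≤ ρn`.  Conclusion: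
`∃ R > 0, ∀ V_k, PlaqSmallOn (plaqsInside (pts k (Z ∩ Λᶜ))) eR V_k → <12Q ∕ 12X-W v11 hMin ∀-body at V_k, radius R, bound 4𝓐₀, class at εr>` — the knit-side terminus of E1 modulo the two
[15] letters.
[cite: Balaban1985Variational, (2)–(7) p.278, Thm 1 (8) p.279, Sect. C (44)–(48) p.285, (81)–(83) p.290, (181) p.307, Prop. 9 (190) p.309; Balaban1989LargeFieldI, (1.74) p.192, p.193 L14–20, Prop. 1 p.194; Balaban1985RegularSpaces, (1.3)–(1.9) p.77; Balaban1989LargeFieldII, (1.12)–(1.13) p.359; Balaban1988Convergent, (2.1)–(2.2) pp.254–255, (2.10)–(2.13) pp.256–257, (2.18) p.257; Balaban1985Averaging, (8)–(9) pp.18–19, Prop. 2 (52)–(54) p.26, (122)–(126) p.36; Balaban1987RG1, (0.4) p.253] -/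
theorem exists_R_hMinRow_of_thm1LettersAtLength_alongOrbit_onZ (ν : Node00.Stage7Numerics) (Kt : ℕ) (hd3 : 3 ≤ (F.P Kt).d) (Z : Set (Site (F.P Kt) 0))
    (hkK : k + 1 ≤ (F.P Kt).m + (F.P Kt).K) (hk1 : 1 ≤ k) (hdiv : side (F.P Kt).L ν.M₁ k ∣ (F.P Kt).sitesPerDir 0) (hfloor : ((F.P Kt).d + 14) * (F.P Kt).L ≤ ν.M₁) (hZblk : IsBlockUnion k Z)
    -- the per-HEIGHT letters (EXISTENCE constants per (instance, height); dag-n12-w6's `N12HsurjOfClass.exists_hsurjLetters`)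
    {ρ'' : ℝ} (hsbU : ∀ W : GaugeField (F.P Kt) 0 SU2, ‖coeField W - 1‖ ≤ ρ'' → SmallBelow (Node00.avOfRecord F 2 Kt) k W) (hρ : 0 < ρ'')
    {εH B : ℝ}
    (hHB : ∀ (Wd : MSField (F.P Kt) SU2) (U₀ : GaugeField (F.P Kt) 0 SU2),
      AgreeOn (Bj ν.M₁ Z k) (avgFamily (avOfRecord F 2 Kt) U₀) Wd →
      (∀ i' : Fin (constrCard (Bj ν.M₁ Z k) k), ∃ U' : GaugeField (F.P Kt) 0 SU2,
        (∀ b ∈ feeds (((constrEnum (Bj ν.M₁ Z k) k).symm i').1 : ℕ) ((constrEnum (Bj ν.M₁ Z k) k).symm i').2.1, U' b = U₀ b) ∧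
          SmallBelow (avOfRecord F 2 Kt) k U') →
      (∀ (j : ℕ), 1 ≤ j → j ≤ k → ∀ y : Site (F.P Kt) j, embIter j y ∈ maxDomT ν.M₁ Z j → ∃ U' : GaugeField (F.P Kt) 0 SU2,
        (∀ c : PBond (F.P Kt) j, (c.src = y ∨ c.tgt = y) → ∀ b₀ : PBond (F.P Kt) 0,
          (iterBlockOf j b₀.src = c.src ∨ iterBlockOf j b₀.src = c.tgt) → (iterBlockOf j b₀.tgt = c.src ∨ iterBlockOf j b₀.tgt = c.tgt) → U' b₀ = U₀ b₀) ∧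
        SmallBelow (avOfRecord F 2 Kt) k U') →
      (∀ (j : ℕ), 1 ≤ j → j ≤ k → ∀ y : Site (F.P Kt) j, embIter j y ∈ maxDomT ν.M₁ Z j →
        PlaqSmallOn (boxPlaqs (fun κ => lift (F.P Kt) (embIter j y) κ - ((((F.P Kt).L ^ j : ℕ) : ℤ) + ((((F.P Kt).L ^ j - 1) / 2 : ℕ) : ℤ)))
          (fun κ => lift (F.P Kt) (embIter j y) κ + ((((F.P Kt).L ^ j : ℕ) : ℤ) + ((((F.P Kt).L ^ j - 1) / 2 : ℕ) : ℤ))) : Set (Plaq (F.P Kt) 0)) εH U₀) →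
      ∃ H : (Fin (constrCard (Bj ν.M₁ Z k) k) → lieSU (Fin 2)) → PBond (F.P Kt) 0 → lieSU (Fin 2),
        (∀ v, fderiv ℝ (msChart F 2 Kt k (Bj ν.M₁ Z k) Wd U₀) 0 (H v) = v) ∧ ∀ v, Real.sqrt (∑ b, ‖H v b‖ ^ 2) ≤ B * ‖v‖) (hB0 : 0 ≤ B)
    -- (σ)_N OF RECORD, onZ EDITION (dag-n12-w6 g18's `N12GaugeLetterLocExplicitOnZLam.exists_gaugeLetterLoc_atRecord_lamBondsSeq_explicit_onZ` inside the lane's U3-onZ), instance-level NUMERICS verbatim: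
    -- NUMERICS (i): a level guard `k + c ≤ m + K` with `4d + m′ + 3 < 2·L^c` (no wrapping), and `M₁ ≥ (4d + m′)·L² + 2d·L + 12` (radii), `m′ = 3·(d·((L−1)∕2)) + 5`
    {c : ℕ} (hkc : k + c ≤ (F.P Kt).m + (F.P Kt).K) (hc : 4 * (F.P Kt).d + (3 * ((F.P Kt).d * (((F.P Kt).L - 1) / 2)) + 5) + 3 < 2 * (F.P Kt).L ^ c)
    (hMrad : (4 * (F.P Kt).d + (3 * ((F.P Kt).d * (((F.P Kt).L - 1) / 2)) + 5)) * (F.P Kt).L ^ 2 + 2 * (F.P Kt).d * (F.P Kt).L + 12 ≤ ν.M₁)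
    -- the family's support numerics: `M₁ ≥ ((d+4)L + 6)·L²`
    (hM₁ : (((F.P Kt).d + 4) * (F.P Kt).L + 6) * (F.P Kt).L ^ 2 ≤ ν.M₁)
    -- THE TWO [15]-THEOREM-1 LETTERS over NODE 00's torus class, READ AT THIS INSTANCE's OWN LENGTH `k`; the (8)-letter `h15T` with the record's (7) row `Sect2.DataSmall7PTop`, the (E∕U)
    -- letter `h15EUT` AT REGULAR-REALISED DATA `B11Thm1ExistsUniqueRealisedDataB.DataRegularRealisedTop …` (dag-n12-c g38 ✓p782648; rows by its `B15Prop1Thm1RowsOfExistsUniqueAtLengthBR`).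
    -- «INHABITED BY» at `bd := lamDatumP` and K0⁷'s grid guard `A‴(c,c₀,c₁)`: `h15T` = the body of the (R)ᴮ name `Node00.VariationalThm1RegSepCoP7MGB F 2 A‴ (lamDatum F) (dataSmall7LamTopOf F 2) …`
    --   through the record's (7) (113 §5) — INHABITED for K0⁷'s stub-1 constants (`K0Stub1BHolds`, 114 ✓p774580); `h15EUT` = the body of the (E∕U)ᴮ name
    --   `B11Thm1ExistsUniqueTokensGB.VariationalThm1EUSepCoP7MGB F 2 A‴ (lamDatum F) (dataRegularRealisedTopOf F 2) …`, which dag-n12-c's `…N12Thm1EUNameBOfStepAtRealisedDataLam` ✓p782822∕✓p782912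
    --   derives from THE ONE-LENGTH STEP TOKEN `VariationalThm1EUStepCoP7MGB F 2 A‴ (lamDatum F) (dataSmall7LamTopOf F 2) C₁ …` ([15] Prop. 2 + Sects. B–E at one length — OPEN, N07);
    --   the composition is dag-n12-d's `…LettersDischargedAtLengthOfK0Stub1BAndStepOfRecord`
    {B₃ a₀ a₁ : ℝ}
    (h15T : ∀ (s : B14.Eq218Concrete.Seq (fun n : ℕ => Node00.unionsOfCubes (F.P Kt) (side (F.P Kt).L ν.M₁ n)) k),
      Node00.Sect2.SeqSeparated ν.M₁ s → 0 < ν.M₁ →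
      ∀ (ε₀ : ℝ) (δ : ℕ → ℝ), (∀ j, j ≤ k → 0 < δ j ∧ δ j ≤ a₁ ∧ B₃ * δ j ≤ ε₀) → (∀ j, j < k → δ j ≤ 2 * δ (j + 1)) →
      (∀ j, j < k → δ (j + 1) ≤ 2 * δ j) → ε₀ ≤ a₀ →
      ∀ W : MSField (F.P Kt) SU2,
        Node00.Sect2.DataSmall7PTop (Node00.avOfRecord F 2 Kt) s.Ω (Node00.suppDomOfRecord F ν Kt s.Ω) k δ W →
        ∀ U₀ : GaugeField (F.P Kt) 0 SU2, IsMinimizerB (Node00.avOfRecord F 2 Kt)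
            {U | (∀ j, j ≤ k → PlaqSmallOn (Node00.Sect2.omegaPlaqsTop s.Ω (Node00.suppDomOfRecord F ν Kt s.Ω) j)
                (ε₀ * (F.P Kt).eta j ^ 2) U) ∧
              Node00.Sect2.CoDivClassOnTop s.Ω (Node00.suppDomOfRecord F ν Kt s.Ω) k ε₀ U}
            (lamBondsSeq s.Ω k) W U₀ →
          (∀ j, j ≤ k → PlaqSmallOn (Node00.Sect2.omegaPlaqsTop s.Ω (Node00.suppDomOfRecord F ν Kt s.Ω) j)
              (B₃ * δ j * (F.P Kt).eta j ^ 2) U₀) ∧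
            ∀ j, j ≤ k → Node00.Sect2.CoDivSmallOn (Node00.Sect2.omegaBondsTop s.Ω (Node00.suppDomOfRecord F ν Kt s.Ω) j)
              (B₃ * δ j * (F.P Kt).eta j ^ 3) U₀)
    (h15EUT : ∀ (s : B14.Eq218Concrete.Seq (fun n : ℕ => Node00.unionsOfCubes (F.P Kt) (side (F.P Kt).L ν.M₁ n)) k),
      Node00.Sect2.SeqSeparated ν.M₁ s → 0 < ν.M₁ →
      ∀ (ε₀ : ℝ) (δ : ℕ → ℝ), (∀ j, j ≤ k → 0 < δ j ∧ δ j ≤ a₁ ∧ B₃ * δ j ≤ ε₀) → (∀ j, j < k → δ j ≤ 2 * δ (j + 1)) →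
      (∀ j, j < k → δ (j + 1) ≤ 2 * δ j) → ε₀ ≤ a₀ →
      ∀ W : MSField (F.P Kt) SU2,
        B11Thm1ExistsUniqueRealisedDataB.DataRegularRealisedTop (Node00.avOfRecord F 2 Kt) s.Ω (Node00.suppDomOfRecord F ν Kt s.Ω) k δ W →
        (∃ U₀ : GaugeField (F.P Kt) 0 SU2, IsMinimizerB (Node00.avOfRecord F 2 Kt)
            {U | (∀ j, j ≤ k → PlaqSmallOn (Node00.Sect2.omegaPlaqsTop s.Ω (Node00.suppDomOfRecord F ν Kt s.Ω) j)
                (ε₀ * (F.P Kt).eta j ^ 2) U) ∧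
              Node00.Sect2.CoDivClassOnTop s.Ω (Node00.suppDomOfRecord F ν Kt s.Ω) k ε₀ U}
            (lamBondsSeq s.Ω k) W U₀) ∧
        ∀ U₁ U₂ : GaugeField (F.P Kt) 0 SU2,
          IsMinimizerB (Node00.avOfRecord F 2 Kt)
            {U | (∀ j, j ≤ k → PlaqSmallOn (Node00.Sect2.omegaPlaqsTop s.Ω (Node00.suppDomOfRecord F ν Kt s.Ω) j)
                (ε₀ * (F.P Kt).eta j ^ 2) U) ∧
              Node00.Sect2.CoDivClassOnTop s.Ω (Node00.suppDomOfRecord F ν Kt s.Ω) k ε₀ U}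
            (lamBondsSeq s.Ω k) W U₁ →
          IsMinimizerB (Node00.avOfRecord F 2 Kt)
            {U | (∀ j, j ≤ k → PlaqSmallOn (Node00.Sect2.omegaPlaqsTop s.Ω (Node00.suppDomOfRecord F ν Kt s.Ω) j)
                (ε₀ * (F.P Kt).eta j ^ 2) U) ∧
              Node00.Sect2.CoDivClassOnTop s.Ω (Node00.suppDomOfRecord F ν Kt s.Ω) k ε₀ U}
            (lamBondsSeq s.Ω k) W U₂ →
          ∃ u : GaugeTransf (F.P Kt) 0 SU2,
            (∀ j, j ≤ k → ∀ b ∈ lamBondsSeq s.Ω k j, toMS u j b.src = toMS u j b.tgt ∧ ∀ g : SU2, toMS u j b.src * g = g * toMS u j b.src) ∧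
              gaugeAct u U₁ = U₂) :
    ∃ δ₀ : ℝ, 0 < δ₀ ∧
    ∀ (Λ : Set (Site (F.P Kt) 0)) (lo hi : Fin (F.P Kt).d → ℤ) (eR : ℝ), 0 < eR →
    ∀ (n : ℕ), (∀ κ, hi κ ≤ lo κ + n) → (∀ κ, ((hi κ - lo κ + 1).toNat : ℤ) + 5 < ((F.P Kt).sitesPerDir k : ℤ)) → lo ≤ hi →
      pts k Λ = (castSite '' Set.Icc lo hi : Set (Site (F.P Kt) k)) → (boxPlaqs (lo - 1) (hi + 1) : Set (Plaq (F.P Kt) k)) ⊆ plaqsInside (pts k Z) →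
    -- THE REGION BOX of the direct road (dag-n12-w6 §7's big box): `LO ≤ lo − 1`, `hi + 1 ≤ HI`, side budget `n′ < sitesPerDir k`, its plaquettes inside `Z^{(k)}`, and BOX SCOPE: every `k`-bond inside `Z^{(k)}` is a bond of the box
    ∀ (LO HI : Fin (F.P Kt).d → ℤ) (n' : ℕ), LO ≤ lo - 1 → hi + 1 ≤ HI → (∀ κ, HI κ ≤ LO κ + n') → n' < (F.P Kt).sitesPerDir k →
      (boxPlaqs LO HI : Set (Plaq (F.P Kt) k)) ⊆ plaqsInside (pts k Z) → {e : PBond (F.P Kt) k | e.src ∈ pts k Z ∧ e.tgt ∈ pts k Z} ⊆ boxBonds LO HI →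
    ∀ {cE : ℝ}, 12 * ((F.P Kt).d : ℝ) * ((n : ℝ) + 2) ^ 2 ≤ cE → 6 * ((((F.P Kt).d - 1 : ℕ)) : ℝ) * (F.P Kt).L ^ k * (2 * ((cE + 1) * eR)) ≤ ρ'' →
    ∀ (ext : GaugeField (F.P Kt) k SU2 → GaugeField (F.P Kt) k SU2), (∀ W, ext W = extend (pts k Λ) (shellGauge W lo hi) W) →
    ∀ {𝓐₀ : ℝ}, 1 < 𝓐₀ →
    ∀ (εr : ℝ), 0 < εr → 12 * ((((F.P Kt).d - 1 : ℕ)) : ℝ) * (F.P Kt).L * εr ≤ ρ'' → εr ≤ εH →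
      (143 * (((((F.P Kt).d + 4 : ℕ) : ℝ)) ^ 2 / 4) ^ 2) * (2 * ((F.P Kt).L : ℝ) ^ 2 * εr) ≤ 1 / 3 →
      2 * (2 * ((F.P Kt).L : ℝ) ^ 2 * εr) ≤ 2 * deltaSU (Fin 2) / ((((F.P Kt).d + 4) * (F.P Kt).L : ℕ) : ℝ) ^ 2 →
    -- [15]'s comparability rows at `ε := 2eR`
    ∀ {ε₀ : ℝ}, (cE + 1) * (2 * eR) ≤ a₁ → B₃ * ((cE + 1) * (2 * eR)) ≤ εr → εr < ε₀ → ε₀ ≤ a₀ →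
    -- the datum bond tolerance `ρn` with U3's «`T(ρn, εr) ≤ δ₀`» row (VERBATIM)
    ∀ {ρn : ℝ}, 0 ≤ ρn →
    (max ρn ((((2 * (∑ i ∈ Finset.range (k + 1), ((F.P Kt).d * (((F.P Kt).L ^ i - 1) / 2) + 1)) + 1 +
                  (3 * ((F.P Kt).d * (((F.P Kt).L - 1) / 2)) + 5) * (F.P Kt).L ^ k : ℕ) : ℝ)) ^ 2 / 4 * (εr * (F.P Kt).eta 0 ^ 2) +
                ((3 * ((F.P Kt).d * (((F.P Kt).L - 1) / 2)) + 5 : ℕ) : ℝ) * (6 * ((((((F.P Kt).d + 2) * (F.P Kt).L : ℕ) : ℝ) ^ 2 / 4) * (2 * (εr * (F.P Kt).L ^ 2))) * ∑ i ∈ Finset.range k, ((F.P Kt).L : ℝ) ^ i) + ((3 * ((F.P Kt).d * (((F.P Kt).L - 1) / 2)) + 5 : ℕ) : ℝ) * ρn) ≤ δ₀) →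
    -- the normaliser's bond tolerance (dag-n12-w6 §7, at `ε := eR`) below the datum tolerance `ρn`
    (((F.P Kt).d : ℝ) * n' + 1) * ((((F.P Kt).d - 1 : ℕ) : ℝ) * n' * ((12 * (F.P Kt).d * (n + 2) ^ 2 + 1) * eR) + 3 * (F.P Kt).d * (n + 2) ^ 2 * eR) ≤ ρn →
    -- NO PER-BASE-FIELD HYPOTHESIS AND NO ANTECEDENT: the knit's `hMin` ∀-body for EVERY base field of the strict guard, bound `4𝓐₀`
    ∃ R : ℝ, 0 < R ∧ ∀ Vk : GaugeField (F.P Kt) k SU2, PlaqSmallOn (plaqsInside (pts k (Z ∩ Λᶜ))) eR Vk →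
      ∃ Ũ : VecField (F.P Kt) k (EuclideanSpace ℂ (Fin 3)) × VecField (F.P Kt) k (EuclideanSpace ℂ (Fin 3)) → PBond (F.P Kt) 0 → Matrix (Fin 2) (Fin 2) ℂ,
        (∀ b i j, DifferentiableOn ℂ (fun z => Ũ z b i j) (ball 0 R)) ∧
        (∀ z ∈ ball (0 : VecField (F.P Kt) k (EuclideanSpace ℂ (Fin 3)) × VecField (F.P Kt) k (EuclideanSpace ℂ (Fin 3))) R, ∀ b i j, ‖Ũ z b i j‖ ≤ 4 * 𝓐₀) ∧
        ∀ p B' : VecField (F.P Kt) k E3, ‖p‖ < R → ‖B'‖ < R → ∃ U' : GaugeField (F.P Kt) 0 SU2,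
          (∀ b, Ũ (cplxVec p, cplxVec B') b = ((U' b : SU2) : Matrix (Fin 2) (Fin 2) ℂ)) ∧
            IsMinimizerB (Node00.avOfRecord F 2 Kt) (Node00.regMSCoPOfRecord F 2 {ν with εreg := εr} Kt k (maxDomT ν.M₁ Z)) (lamBondsSeq (maxDomT ν.M₁ Z) k)
              (avgFamily (Node00.avOfRecord F 2 Kt) (qsstarGIter0 k (expMul su2Chart B' (ext (expMul su2Chart p Vk))))) U' := by
  obtain ⟨δ₀, hδ₀, h⟩ := exists_R_hMinRow_of_thm1LettersAtLength_onDatumSliceOnZ ν Kt hd3 Z hkK hk1 hdiv hfloor hZblk hsbU hρ hHB hB0 hkc hc hMrad hM₁ h15T h15EUT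
  refine ⟨δ₀, hδ₀, ?_⟩
  intro Λ lo hi eR heR n hn hN5 hlohi hbox hZ LO HI n' hLO hHI hn' hn'N hRbox h𝒞 cE hcE hδρ ext hext 𝓐₀ h𝓐₀ εr hεr hερ hεH hα3 hα2 ε₀ hεa₁ hB₃ε hεr0 hε₀ ρn hρn hT hCρ
  obtain ⟨R, hR, h'⟩ := h Λ lo hi eR heR n hn hN5 hlohi hbox hZ hcE hδρ ext hext h𝓐₀ εr hεr hερ hεH hα3 hα2 hεa₁ hB₃ε hεr0 hε₀ hρn hT
  have hN3 := boxRow3_of_boxRow5 hlohi hN5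
  -- the lane's orbit composition (dag-n12-w6's normalising gauge + gauge covariance of the minimiser family): radius `R∕3`, bound `4𝓐₀`
  exact ⟨R / 3, by positivity, hMinBody_of_datumSlice {ν with εreg := εr} Kt (by omega) hd3 lamDatumP Z Λ (fun j hj => lamBondsSeq_of_gt _ _ (by omega)) hlohi hn hN3 hbox hZ hLO hHI hn' hn'N hRbox ext hext
    {e : PBond (F.P Kt) k | e.src ∈ pts k Z ∧ e.tgt ∈ pts k Z} h𝒞 heR hCρ h'⟩

end

end Summit.QuantumFields.YangMills.BalabanUVNodes.N12MinimiserFamilyKnitRowThm1LettersAtLengthOnZBR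

end
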